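import Literature.NumberTheory.EllipticCurves.TateModuleProofs
import Literature.NumberTheory.EllipticCurves.GaloisActionProofs
import Literature.NumberTheory.EllipticCurves.WeilPairingProofs
import HarnessLib

/-!
# Class X9 toolkit: Galois elements acting by a unipotent shear on a frame of `E[m]`
# (cell `b2b-bsdres`, unit `b2b-bsdres-x9`, gen 9; part 1 of `surj(p) ∧ p ≥ 5 ⟹ (im)`)

HONEST FRAMING (run/shared/lean/b2b/bsd-rank1-residual/, verbatim in every file): the goal of the
cell is to DELETE the COMBINATION-SHAPED residual classes of the Birch–Swinnerton-Dyer formula for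
ALL analytic-rank `≤ 1` elliptic curves over `ℚ` — "full BSD formula for every rank `≤ 1` curve in
class `C`" assembled STRICTLY from published theorems — so that the rank-`≤ 1` remainder becomes
exactly the CONSTRUCTION-SHAPED classes, which are TYPED (missing-input `Prop`s), NOT attempted.
This is not "finishing BSD". Nothing here is a class theorem; no named fact (theorems only; our own
work, hence `Summits/`).

For a Weierstrass curve `W` over a field `F`, with `E(F̄) = geomPoints W` and its `Γ_F`-action
(`Literature/…/EllipticCurves/GaloisAction.lean`):
* `isOpen_setOf_smul_point_eq`, `isClosed_setOf_smul_point_eq`: the fibres `{σ | σP = Q}` of the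
  orbit map of a geometric point are clopen in the Krull topology (from the tree theorem
  `isOpen_stabilizer_point_holds`: `E(F̄)` is a discrete `Γ_F`-module);
* `exists_smul_eq_shear_of_hasSurjectiveModNGaloisRep`: if `(P, Q)` is a `ℤ/m`-frame of `E[m]`
  (`m ≥ 2`) and `ρ̄_{E,m} : Γ_F → Aut(E[m])` is onto, some `σ` acts by the shear `σP = P`,
  `σQ = P + Q`;
* `smul_eq_self_of_pow_eq_one_of_shear`: such a `σ` fixes every `m`-th root of unity of `F̄`
  (`F` perfect, `m` invertible): by the Weil pairing (tree theorem `exists_weilPairing_holds`,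
  Silverman *AEC* III.8.1) `ζ = e_m(P, Q)` is `σ`-invariant and a primitive `m`-th root of unity —
  the shear has `det = 1 = χ_m(σ)` (Silverman in Cornell–Silverman–Stevens, Ch. II §7).
The consumer is `Summits/BirchSwinnertonDyer/Rank1Residual/X9/SurjBigImage.lean` (`bigIm_of_surj`:
for `p ≥ 5`, `ρ̄_{E,p}` onto ⟹ BCS's hypothesis (im)), closing finding F2 of the cell's partition lemma.

## References

* [SilvermanAEC2009] J. H. Silverman, *AEC*, III.6.4, III.§7, III.8.1.
* [SilvermanCSS1997] J. H. Silverman, in Cornell–Silverman–Stevens (1997), Ch. II §7–8.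
* [Serre1972] J.-P. Serre, Invent. Math. 15 (1972), §4 (the framed mod-`m` representation).
-/

noncomputable section

open scoped Classical

open WeierstrassCurve Field Literature.NumberTheory.EllipticCurves

namespace Summit.BirchSwinnertonDyer.Rank1Residual.X9

section General

variable {F : Type} [Field F] (W : WeierstrassCurve F)

/-- **The orbit map of a geometric point has open fibres.**  For `P, Q ∈ E(F̄)` the set
`{σ ∈ Γ_F | σP = Q}` is open in the Krull topology: it is empty or a left translate of the
stabiliser of `P`, which is open (`isOpen_stabilizer_point_holds`: `E(F̄)` is a discrete
`Γ_F`-module; Serre, *Galois Cohomology* II.§1). [folklore] -/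
theorem isOpen_setOf_smul_point_eq (P Q : geomPoints W) :
    IsOpen {σ : absoluteGaloisGroup F | σ • P = Q} := by
  by_cases h : ∃ τ : absoluteGaloisGroup F, τ • P = Q
  · obtain ⟨τ, hτ⟩ := h
    have hst := isOpen_stabilizer_point_holds W P
    have hcont : Continuous fun σ : absoluteGaloisGroup F => τ⁻¹ * σ :=
      continuous_const.mul continuous_id
    have heq : {σ : absoluteGaloisGroup F | σ • P = Q} =
        (fun σ : absoluteGaloisGroup F => τ⁻¹ * σ) ⁻¹'
          ((MulAction.stabilizer (absoluteGaloisGroup F) P : Subgroup _) :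
            Set (absoluteGaloisGroup F)) := by
      ext σ
      simp only [Set.mem_setOf_eq, Set.mem_preimage, SetLike.mem_coe, MulAction.mem_stabilizer_iff,
        mul_smul]
      constructor
      · intro h
        rw [h, ← hτ, ← mul_smul, inv_mul_cancel, one_smul]
      · intro h
        have := congrArg (τ • ·) h
        simp only [← mul_smul, mul_inv_cancel_left] at this
        rw [this, hτ]
    rw [heq]
    exact hst.preimage hcont
  · have heq : {σ : absoluteGaloisGroup F | σ • P = Q} = ∅ := by
      ext σ
      simp only [Set.mem_setOf_eq, Set.mem_empty_iff_false, iff_false]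
      exact fun hσ => h ⟨σ, hσ⟩
    rw [heq]
    exact isOpen_empty

/-- **The orbit map of a geometric point has closed fibres**: `{σ ∈ Γ_F | σP = Q}` is closed (the
orbit map `σ ↦ σP` into the discrete module `E(F̄)` is locally constant, hence continuous).
Serre, *Galois Cohomology* II.§1. [folklore] -/
theorem isClosed_setOf_smul_point_eq (P Q : geomPoints W) :
    IsClosed {σ : absoluteGaloisGroup F | σ • P = Q} := by
  have hlc : IsLocallyConstant fun σ : absoluteGaloisGroup F => σ • P := by
    rw [IsLocallyConstant.iff_isOpen_fiber]
    intro Q'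
    exact isOpen_setOf_smul_point_eq W P Q'
  exact (isClosed_discrete {Q}).preimage hlc.continuous

/-- Additivity of a level frame: for `P, Q ∈ E[m]` the map `(x, y) ↦ x P + y Q` on `(ℤ/m)²`
(scalars through `ZMod.val`) is additive, since `m P = m Q = 0`. Silverman, *AEC* III.§7. [folklore] -/
theorem val_smul_frame_add {m : ℕ} [NeZero m] {P Q : geomPoints W}
    (hP : P ∈ geomTorsion W (m : ℤ)) (hQ : Q ∈ geomTorsion W (m : ℤ)) (x y : ZMod m × ZMod m) :
    (x + y).1.val • P + (x + y).2.val • Q =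
      (x.1.val • P + x.2.val • Q) + (y.1.val • P + y.2.val • Q) := by
  have h1 : (x + y).1 = (((x.1.val + y.1.val : ℕ)) : ZMod m) := by
    rw [Nat.cast_add, ZMod.natCast_zmod_val, ZMod.natCast_zmod_val]; rfl
  have h2 : (x + y).2 = (((x.2.val + y.2.val : ℕ)) : ZMod m) := by
    rw [Nat.cast_add, ZMod.natCast_zmod_val, ZMod.natCast_zmod_val]; rfl
  rw [h1, h2, TateModule.val_natCast_smul_of_mem_torsionBy hP,
    TateModule.val_natCast_smul_of_mem_torsionBy hQ, add_nsmul, add_nsmul]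
  abel

/-- **The shear is realised by Galois when `ρ̄_{E,m}` is onto.**  Let `P, Q ∈ E[m]` (`m ≥ 2`) be a
`ℤ/m`-frame of `E[m]`, i.e. `(x, y) ↦ x P + y Q : (ℤ/m)² → E[m]` is bijective (`L`, `hL`).  If the
mod-`m` representation `Γ_F → Aut(E[m])` is surjective, some `σ ∈ Γ_F` acts by the unipotent shear
`σP = P`, `σQ = P + Q` (transport `(x, y) ↦ (x + y, y)` along the frame to an additive automorphism
of `E[m]` and lift it). Serre 1972 §4 (the framed representation). [folklore] -/
theorem exists_smul_eq_shear_of_hasSurjectiveModNGaloisRep {m : ℕ} (hm : 2 ≤ m)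
    (hsurjm : W.HasSurjectiveModNGaloisRep (m : ℤ)) {P Q : geomPoints W}
    (hP : P ∈ geomTorsion W (m : ℤ)) (hQ : Q ∈ geomTorsion W (m : ℤ))
    (L : ZMod m × ZMod m → geomTorsion W (m : ℤ))
    (hL : ∀ xy, (L xy : geomPoints W) = xy.1.val • P + xy.2.val • Q)
    (hLbij : Function.Bijective L) :
    ∃ σ : absoluteGaloisGroup F, σ • P = P ∧ σ • Q = P + Q := by
  have hm1 : m ≠ 1 := by omega
  haveI : NeZero m := ⟨by omega⟩
  -- `L` as an additive isomorphism `(ℤ/m)² ≃ E[m]`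
  have hLadd : ∀ x y, L (x + y) = L x + L y := fun x y => by
    apply Subtype.ext
    rw [AddSubgroup.coe_add, hL, hL, hL]
    exact val_smul_frame_add W hP hQ x y
  let Le : (ZMod m × ZMod m) ≃+ geomTorsion W (m : ℤ) :=
    AddEquiv.ofBijective (AddMonoidHom.mk' L hLadd) hLbij
  have hLe : ∀ xy, Le xy = L xy := fun xy => rfl
  -- the shear `(x, y) ↦ (x + y, y)` of `(ℤ/m)²`
  let sh : (ZMod m × ZMod m) ≃+ (ZMod m × ZMod m) :=
    { toFun := fun xy => (xy.1 + xy.2, xy.2)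
      invFun := fun xy => (xy.1 - xy.2, xy.2)
      left_inv := fun xy => by simp
      right_inv := fun xy => by simp
      map_add' := fun xy zw => by
        simp only [Prod.fst_add, Prod.snd_add, Prod.mk_add_mk]
        abel_nf }
  let φ : geomTorsion W (m : ℤ) ≃+ geomTorsion W (m : ℤ) := (Le.symm.trans sh).trans Le
  -- lift `φ` to Galois
  obtain ⟨σ, hσ⟩ := hsurjm (Multiplicative.ofAdd φ)
  have hσP : ∀ R : geomTorsion W (m : ℤ), σ • R = φ R := fun R ↦ by
    rw [← galoisRepTorsion_apply W m σ R, hσ]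
    rfl
  have h10 : Le (1, 0) = ⟨P, hP⟩ := by
    apply Subtype.ext
    rw [hLe, hL]
    simp [ZMod.val_one'' hm1]
  have h01 : Le (0, 1) = ⟨Q, hQ⟩ := by
    apply Subtype.ext
    rw [hLe, hL]
    simp [ZMod.val_one'' hm1]
  have h11 : Le (1, 1) = ⟨P + Q, add_mem hP hQ⟩ := by
    apply Subtype.ext
    rw [hLe, hL]
    simp [ZMod.val_one'' hm1]
  refine ⟨σ, ?_, ?_⟩
  · have hs : Le.symm ⟨P, hP⟩ = (1, 0) := by rw [← h10, AddEquiv.symm_apply_apply]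
    have : ((σ • (⟨P, hP⟩ : geomTorsion W (m : ℤ)) : geomTorsion W (m : ℤ)) : geomPoints W) = P := by
      rw [hσP]
      change ((Le (sh (Le.symm ⟨P, hP⟩)) : geomTorsion W (m : ℤ)) : geomPoints W) = P
      rw [hs]
      change ((Le ((1 : ZMod m) + 0, 0) : geomTorsion W (m : ℤ)) : geomPoints W) = P
      rw [add_zero, h10]
    simpa [AddSubgroup.torsionBy.coe_smul] using this
  · have hs : Le.symm ⟨Q, hQ⟩ = (0, 1) := by rw [← h01, AddEquiv.symm_apply_apply]
    have : ((σ • (⟨Q, hQ⟩ : geomTorsion W (m : ℤ)) : geomTorsion W (m : ℤ)) : geomPoints W) =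
        P + Q := by
      rw [hσP]
      change ((Le (sh (Le.symm ⟨Q, hQ⟩)) : geomTorsion W (m : ℤ)) : geomPoints W) = P + Q
      rw [hs]
      change ((Le ((0 : ZMod m) + 1, 1) : geomTorsion W (m : ℤ)) : geomPoints W) = P + Q
      rw [zero_add, h11]
    simpa [AddSubgroup.torsionBy.coe_smul] using this

/-- **An element acting by the shear on a frame of `E[m]` fixes `μ_m`** (`F` perfect, `m ≥ 2`
invertible in `F`).  If `(P, Q)` is a `ℤ/m`-frame of `E[m]` and `σP = P`, `σQ = P + Q`, then `σ`
fixes every `m`-th root of unity of `F̄`: with the Weil pairing `e_m` (tree theorem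
`exists_weilPairing_holds`, Silverman *AEC* III.8.1) the value `ζ = e_m(P, Q)` is `σ`-invariant
(`e_m(P, P + Q) = e_m(P, Q)`) and is a primitive `m`-th root of unity by non-degeneracy, so every
`m`-th root of unity is a power of `ζ`.  This is `det ρ̄_m(σ) = 1 = χ_m(σ)` (Silverman, in
Cornell–Silverman–Stevens, Ch. II §7) for the shear. [folklore] -/
theorem smul_eq_self_of_pow_eq_one_of_shear [PerfectField F] [W.IsElliptic] {m : ℕ} (hm : 2 ≤ m)
    (hmF : (m : F) ≠ 0) {P Q : geomPoints W} (hP : P ∈ geomTorsion W (m : ℤ))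
    (hQ : Q ∈ geomTorsion W (m : ℤ)) (L : ZMod m × ZMod m → geomTorsion W (m : ℤ))
    (hL : ∀ xy, (L xy : geomPoints W) = xy.1.val • P + xy.2.val • Q)
    (hLbij : Function.Bijective L) {σ : absoluteGaloisGroup F} (hσP : σ • P = P)
    (hσQ : σ • Q = P + Q) {t : AlgebraicClosure F} (ht : t ^ m = 1) : σ • t = t := by
  have hm0 : m ≠ 0 := by omega
  haveI : NeZero m := ⟨hm0⟩
  obtain ⟨w, hpow, haddl, haddr, halt, hnd, hgal⟩ := exists_weilPairing_holds W m hm hmF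
  -- elementary consequences of bilinearity
  have hne : ∀ S T, w S T ≠ 0 := fun S T h0 ↦ by
    have := hpow S T
    rw [h0, zero_pow hm0] at this
    exact zero_ne_one this
  have hzero_left : ∀ T, w 0 T = 1 := fun T ↦ by
    have h := haddl 0 0 T
    rw [add_zero] at h
    exact (mul_eq_left₀ (hne 0 T)).mp h.symm
  have hzero_right : ∀ S, w S 0 = 1 := fun S ↦ by
    have h := haddr S 0 0
    rw [add_zero] at h
    exact (mul_eq_left₀ (hne S 0)).mp h.symm
  have hnsmul_left : ∀ (x : ℕ) S T, w (x • S) T = w S T ^ x := fun x S T ↦ by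
    induction x with
    | zero => rw [zero_nsmul, pow_zero, hzero_left]
    | succ x ih => rw [succ_nsmul, haddl, ih, pow_succ]
  have hnsmul_right : ∀ (x : ℕ) S T, w S (x • T) = w S T ^ x := fun x S T ↦ by
    induction x with
    | zero => rw [zero_nsmul, pow_zero, hzero_right]
    | succ x ih => rw [succ_nsmul, haddr, ih, pow_succ]
  -- the frame inside `E[m]`
  set S : geomTorsion W (m : ℤ) := ⟨P, hP⟩ with hSdef
  set T : geomTorsion W (m : ℤ) := ⟨Q, hQ⟩ with hTdef
  have hσS : σ • S = S := Subtype.ext (by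
    rw [Literature.NumberTheory.EllipticCurves.AddSubgroup.torsionBy.coe_smul]; exact hσP)
  have hσT : σ • T = S + T := Subtype.ext (by
    rw [Literature.NumberTheory.EllipticCurves.AddSubgroup.torsionBy.coe_smul, AddSubgroup.coe_add]
    exact hσQ)
  -- `ζ = w S T` is fixed by `σ`
  have hfix : σ • w S T = w S T := by rw [hgal, hσS, hσT, haddr, halt, one_mul]
  -- every point of `E[m]` is `x S + y T`
  have hdecomp : ∀ R : geomTorsion W (m : ℤ), ∃ x y : ℕ, R = x • S + y • T := fun R ↦ by
    obtain ⟨xy, hxy⟩ := hLbij.2 R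
    refine ⟨xy.1.val, xy.2.val, Subtype.ext ?_⟩
    rw [← hxy, hL, AddSubgroup.coe_add, AddSubgroupClass.coe_nsmul, AddSubgroupClass.coe_nsmul]
  -- `ζ` has order exactly `m` (non-degeneracy)
  have hord : orderOf (w S T) = m := by
    refine Nat.dvd_antisymm (orderOf_dvd_of_pow_eq_one (hpow S T)) ?_
    set d := orderOf (w S T) with hd
    have hdT : d • T = 0 := hnd (d • T) fun R ↦ by
      obtain ⟨x, y, rfl⟩ := hdecomp R
      rw [haddl, hnsmul_left, hnsmul_left, hnsmul_right, hnsmul_right, halt T, one_pow, one_pow,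
        mul_one, hd, pow_orderOf_eq_one, one_pow]
    have hL0d : L (0, (d : ZMod m)) = L (0, 0) := by
      apply Subtype.ext
      rw [hL, hL, TateModule.val_natCast_smul_of_mem_torsionBy hQ]
      simp only [ZMod.val_zero, zero_smul, zero_add]
      have := congrArg Subtype.val hdT
      rwa [AddSubgroupClass.coe_nsmul, ZeroMemClass.coe_zero] at this
    have h0 : ((d : ZMod m)) = 0 := by
      have := hLbij.1 hL0d
      simpa using congrArg Prod.snd this
    exact (ZMod.natCast_eq_zero_iff d m).mp h0
  have hprim : IsPrimitiveRoot (w S T) m := hord ▸ IsPrimitiveRoot.orderOf (w S T)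
  obtain ⟨i, -, rfl⟩ := hprim.eq_pow_of_pow_eq_one ht
  rw [smul_pow', hfix]

end General

end Summit.BirchSwinnertonDyer.Rank1Residual.X9
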